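import Summits.QuantumFields.YangMills.Theorems.UnitScaleTiltProp7CovLaplaceSpectralSplit
import Literature.MathematicalPhysics.QuantumFieldTheory.Balaban1983to89.B10StarCount
import HarnessLib

/-!
# Route `UnitScaleTilt`, crux K1 «MinimiserStabilityRegPr» (stmt-QuantumFields-19200), route-R E′ growth side S3, K-FORM engine row R1 = hKg-K — THE FAST HALF (R1-FAST):
# `K_W(D_W f) ≤ 4d²·a²·Σ_x‖f(x)‖² ≤ (4d²·a²∕t)·Σ_b |D_W f(b)|²_HS` for a site field `f` in the FAST sector of `Δ_W` (`t·Σ|f|² ≤ Σ_b|D_Wf|²`), IN THE `covD` LETTERS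

Cell `ym3-torus`, width seat `ym3-torus-px12` (gen 3); namer ★ym-ust-19200-p1 g15 2026-08-28 21:04:46Z «px12 g3: R1-FAST — GO» (target ★`plaqK_covD_fast_le`, letters: the four-term
`ℒ_p` of the (α′) knit ∕ ✓`Prop7GaugeDirPlaqK`, `D_W f` as `covD (torusT P i) (unitsField ∘ toUField W)`).  THEOREMS ONLY (0 `def`, 0 `sorry`); `--supports stmt-QuantumFields-19200 --as helper`,
count-neutral.  YM₃ on T³ is a ladder rung (R3), not the Clay problem; nothing here claims the stub, the crux, d = 4 or the mass gap.

THE POINT.  R1 = hKg-K `K_gauge(φ₀) ≤ C_g·K_W(Y) + θ_g·e·ℓ⁻²M(Y)` splits by the spectral threshold split of `Δ_W` (✓`Prop7CovLaplaceSpectralSplit.exists_slow_fast_siteField(_T3)`,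
`φ₀ = s + f`): the SLOW half stays displayed (the 3-mode alignment row, `C_g ≤ 1.3` numerically), the FAST half is a THEOREM — ✓`Prop7GaugeDirPlaqK.plaqK_gaugeDir_le_sites` (the `[F,ψ]`
booking `K_W(Z^λ) ≤ 4a²d²Σ‖λ‖²`) composed with the fast row (✓`Prop7CovLaplaceSpectralSplit.sum_normSq_fast_le` ∕ `plaqK_gaugeDir_fast_le`, which state it for the gauge-direction letter
`Z^f_b = f(b₋) − W_b f(b₊) W_b^*`).  This file re-letters it ON THE NOSE for the bond field the R5 assembly carries, `D_b = (D_W f)(b) = covD (torusT P i) (unitsField ∘ toUField W) b.dir f b.src`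
(`= −Z^f_b`, ✓`Prop7GaugeDirPlaqK.gaugeDir_eq_neg_covD`; `K_W` is even), with the Dirichlet energy written BOTH as `Σ_μ Σ_x` and as the bond sum `Σ_{b : PBond}` of
✓`exists_slow_fast_siteField_T3`'s fast conjunct.

WHAT IS PROVED (ns `…Theorems.Prop7CovDPlaqKFast`; any `P : Params`, level `i`, `SU(N)`): `covD_eq_gaugeDir_neg` (`D_W f = Z^{−f}` in the door's letters) · ★`plaqK_covD_le_sites`
(`K_W(D_W f) ≤ 4a²·(d²·Σ_x‖f x‖²)`, no sector hypothesis) · ★★`plaqK_covD_fast_le` (`≤ 4a²·(d²·(t⁻¹·Σ_μΣ_x|D_{W,μ}f(x)|²_HS))`) · ★★`plaqK_covD_fast_le_pbond` (the same with the bond sum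
`t⁻¹·Σ_{b : PBond P i}|D_W f(b)|²_HS` on the right and in the fast hypothesis — the T³ reading's currency).  At `a = eℓ⁻²`, `t = c·a`: coefficient `(4d²∕c)·e·ℓ⁻²` — currency (eM).
HONEST SCOPE.  Re-lettering of landed theorems; no new estimate; the SLOW half of R1 is not touched.

References: T. Bałaban, CMP 102 (1985) 277–309 [Balaban1985Variational] ((6) p.278, (47)–(48) pp.285–286, (141)–(143) p.299); CMP 99 (1985) 389–434 [Balaban1985BackgroundPropagators]
((3.3)–(3.4) pp.390–391, (3.117)–(3.122) pp.419–420, Thm 3.11 p.416).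
-/

set_option autoImplicit false

noncomputable section

open scoped BigOperators Matrix.Norms.L2Operator Matrix

namespace Summit.QuantumFields.YangMills.Theorems.Prop7CovDPlaqKFast

open Literature.MathematicalPhysics.QuantumFieldTheory.Balaban1983to89
open B9Eq39Adjoint (covD)
open B9TorusCalculus (torusT)
open B10Eq27TorusAxialLog (unitsField toUField)
open B10StarCount (sum_pbond)
open Summit.QuantumFields.YangMills.Theorems.Prop7GaugeDirPlaqK (gaugeDir_eq_neg_covD plaqK_gaugeDir_le_sites)
open Summit.QuantumFields.YangMills.Theorems.Prop7CovLaplaceSpectralSplit (sum_normSq_fast_le)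

variable {P : Params} {i : ℕ} {N : ℕ}

/-- `D_W f` IS the gauge direction of `−f` in the door's letters: `covD (torusT P i) (unitsField ∘ toUField W) κ f z = (−f)(z) − W_{(z,κ)}·(−f)(z + e_κ)·W_{(z,κ)}^*`
(✓`Prop7GaugeDirPlaqK.gaugeDir_eq_neg_covD` read backwards). [cite: Balaban1985BackgroundPropagators, (3.3) p.390] -/
theorem covD_eq_gaugeDir_neg (W : GaugeField P i (Matrix.specialUnitaryGroup (Fin N) ℂ)) (f : Site P i → Matrix (Fin N) (Fin N) ℂ) (b : PBond P i) :
    covD (torusT P i) (fun κ z => unitsField (toUField W) ⟨z, κ⟩) b.dir f b.src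
      = (fun x => -f x) b.src - (W b : Matrix (Fin N) (Fin N) ℂ) * (fun x => -f x) (b.src.shift b.dir) * star (W b : Matrix (Fin N) (Fin N) ℂ) := by
  have h := gaugeDir_eq_neg_covD W f b.dir b.src
  have hb : (⟨b.src, b.dir⟩ : PBond P i) = b := rfl
  rw [hb] at h
  rw [← neg_neg (covD (torusT P i) (fun κ z => unitsField (toUField W) ⟨z, κ⟩) b.dir f b.src), ← h]
  simp only [neg_sub, Matrix.mul_neg, Matrix.neg_mul]
  abel

variable [NeZero N]

/-- ★ **`K_W(D_W f) ≤ 4a²·d²·Σ_x‖f(x)‖²`** under the plaquette clause `dist1(W(∂p)) ≤ a` — the `[F,ψ]` booking of ✓`Prop7GaugeDirPlaqK.plaqK_gaugeDir_le_sites` in the `covD` letter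
(no sector hypothesis; `‖−f‖ = ‖f‖`). [cite: Balaban1985Variational, (6) p.278, (47)-(48) pp.285-286; Balaban1985BackgroundPropagators, (3.4) p.391] -/
theorem plaqK_covD_le_sites (W : GaugeField P i (Matrix.specialUnitaryGroup (Fin N) ℂ)) {a : ℝ}
    (hW : ∀ p : Plaq P i, dist1 (GaugeField.plaqHol W p) ≤ a) (f : Site P i → Matrix (Fin N) (Fin N) ℂ)
    (D : PBond P i → Matrix (Fin N) (Fin N) ℂ)
    (hD : ∀ b : PBond P i, D b = covD (torusT P i) (fun κ z => unitsField (toUField W) ⟨z, κ⟩) b.dir f b.src) :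
    (∑ p : Plaq P i, ‖((Complex.I • D ⟨p.src, p.μ⟩)
          + ((W ⟨p.src, p.μ⟩ : Matrix (Fin N) (Fin N) ℂ) * (Complex.I • D ⟨p.src.shift p.μ, p.ν⟩) * star (W ⟨p.src, p.μ⟩ : Matrix (Fin N) (Fin N) ℂ))
          - (((W ⟨p.src, p.μ⟩ * W ⟨p.src.shift p.μ, p.ν⟩ * (W ⟨p.src.shift p.ν, p.μ⟩)⁻¹ : Matrix.specialUnitaryGroup (Fin N) ℂ) : Matrix (Fin N) (Fin N) ℂ)
              * (Complex.I • D ⟨p.src.shift p.ν, p.μ⟩)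
              * star ((W ⟨p.src, p.μ⟩ * W ⟨p.src.shift p.μ, p.ν⟩ * (W ⟨p.src.shift p.ν, p.μ⟩)⁻¹ : Matrix.specialUnitaryGroup (Fin N) ℂ) : Matrix (Fin N) (Fin N) ℂ))
          - (((GaugeField.plaqHol W p : Matrix.specialUnitaryGroup (Fin N) ℂ) : Matrix (Fin N) (Fin N) ℂ) * (Complex.I • D ⟨p.src, p.ν⟩)
              * star ((GaugeField.plaqHol W p : Matrix.specialUnitaryGroup (Fin N) ℂ) : Matrix (Fin N) (Fin N) ℂ)))‖ ^ 2)
      ≤ 4 * a ^ 2 * ((P.d : ℝ) ^ 2 * ∑ x : Site P i, ‖f x‖ ^ 2) := by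
  have h := plaqK_gaugeDir_le_sites W hW (fun x => -f x) D (fun b => by rw [hD b]; exact covD_eq_gaugeDir_neg W f b)
  simpa only [norm_neg] using h

/-- ★★ **R1-FAST: `K_W(D_W f) ≤ 4a²·d²·t⁻¹·Σ_μΣ_x |D_{W,μ}f(x)|²_HS`** for `f` in the FAST sector of `Δ_W` at threshold `t > 0` (`t·Σ_x|f(x)|²_HS ≤ Σ_μΣ_x|D_{W,μ}f(x)|²_HS`, the fast
conjunct of ✓`Prop7CovLaplaceSpectralSplit.exists_slow_fast_siteField`) under the plaquette clause `dist1(W(∂p)) ≤ a`.  At `a = eℓ⁻²`, `t = c·a` the coefficient is `(4d²∕c)·e·ℓ⁻²` —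
currency (eM) of the K-form engine. [cite: Balaban1985Variational, (6) p.278, (47)-(48) pp.285-286, (141)-(143) p.299; Balaban1985BackgroundPropagators, (3.4) p.391, (3.117)-(3.122) pp.419-420] -/
theorem plaqK_covD_fast_le (W : GaugeField P i (Matrix.specialUnitaryGroup (Fin N) ℂ)) {a t : ℝ}
    (hW : ∀ p : Plaq P i, dist1 (GaugeField.plaqHol W p) ≤ a) (ht : 0 < t) (f : Site P i → Matrix (Fin N) (Fin N) ℂ)
    (hfast : t * ∑ x : Site P i, ∑ a : Fin N, ∑ b : Fin N, Complex.normSq (f x a b)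
      ≤ ∑ μ : Fin P.d, ∑ x : Site P i, ∑ a : Fin N, ∑ b : Fin N,
          Complex.normSq (covD (torusT P i) (fun κ z => unitsField (toUField W) ⟨z, κ⟩) μ f x a b))
    (D : PBond P i → Matrix (Fin N) (Fin N) ℂ)
    (hD : ∀ b : PBond P i, D b = covD (torusT P i) (fun κ z => unitsField (toUField W) ⟨z, κ⟩) b.dir f b.src) :
    (∑ p : Plaq P i, ‖((Complex.I • D ⟨p.src, p.μ⟩)
          + ((W ⟨p.src, p.μ⟩ : Matrix (Fin N) (Fin N) ℂ) * (Complex.I • D ⟨p.src.shift p.μ, p.ν⟩) * star (W ⟨p.src, p.μ⟩ : Matrix (Fin N) (Fin N) ℂ))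
          - (((W ⟨p.src, p.μ⟩ * W ⟨p.src.shift p.μ, p.ν⟩ * (W ⟨p.src.shift p.ν, p.μ⟩)⁻¹ : Matrix.specialUnitaryGroup (Fin N) ℂ) : Matrix (Fin N) (Fin N) ℂ)
              * (Complex.I • D ⟨p.src.shift p.ν, p.μ⟩)
              * star ((W ⟨p.src, p.μ⟩ * W ⟨p.src.shift p.μ, p.ν⟩ * (W ⟨p.src.shift p.ν, p.μ⟩)⁻¹ : Matrix.specialUnitaryGroup (Fin N) ℂ) : Matrix (Fin N) (Fin N) ℂ))
          - (((GaugeField.plaqHol W p : Matrix.specialUnitaryGroup (Fin N) ℂ) : Matrix (Fin N) (Fin N) ℂ) * (Complex.I • D ⟨p.src, p.ν⟩)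
              * star ((GaugeField.plaqHol W p : Matrix.specialUnitaryGroup (Fin N) ℂ) : Matrix (Fin N) (Fin N) ℂ)))‖ ^ 2)
      ≤ 4 * a ^ 2 * ((P.d : ℝ) ^ 2 * (t⁻¹ * ∑ μ : Fin P.d, ∑ x : Site P i, ∑ a : Fin N, ∑ b : Fin N,
          Complex.normSq (covD (torusT P i) (fun κ z => unitsField (toUField W) ⟨z, κ⟩) μ f x a b))) :=
  (plaqK_covD_le_sites W hW f D hD).trans
    (mul_le_mul_of_nonneg_left (mul_le_mul_of_nonneg_left
      (sum_normSq_fast_le (fun κ z => unitsField (toUField W) ⟨z, κ⟩) ht f hfast).2 (by positivity)) (by positivity))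

omit [NeZero N] in
/-- The Dirichlet energy as a sum over directions and sites equals the sum over positively oriented bonds. [folklore] -/
theorem sum_dir_site_normSq_covD_eq_sum_pbond (W : GaugeField P i (Matrix.specialUnitaryGroup (Fin N) ℂ)) (f : Site P i → Matrix (Fin N) (Fin N) ℂ) :
    ∑ μ : Fin P.d, ∑ x : Site P i, ∑ a : Fin N, ∑ b : Fin N, Complex.normSq (covD (torusT P i) (fun κ z => unitsField (toUField W) ⟨z, κ⟩) μ f x a b)
      = ∑ b : PBond P i, ∑ a : Fin N, ∑ b' : Fin N, Complex.normSq (covD (torusT P i) (fun κ z => unitsField (toUField W) ⟨z, κ⟩) b.dir f b.src a b') := by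
  rw [sum_pbond, Finset.sum_comm]

/-- ★★ **R1-FAST, BOND-SUM CURRENCY** (the fast conjunct and the right side written with `Σ_{b : PBond}` as in ✓`Prop7CovLaplaceSpectralSplit.exists_slow_fast_siteField_T3`):
`K_W(D_W f) ≤ 4a²·d²·t⁻¹·Σ_{b}|D_W f(b)|²_HS`. [cite: Balaban1985Variational, (6) p.278, (47)-(48) pp.285-286, (141)-(143) p.299; Balaban1985BackgroundPropagators, (3.4) p.391, (3.117)-(3.122) pp.419-420] -/
theorem plaqK_covD_fast_le_pbond (W : GaugeField P i (Matrix.specialUnitaryGroup (Fin N) ℂ)) {a t : ℝ}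
    (hW : ∀ p : Plaq P i, dist1 (GaugeField.plaqHol W p) ≤ a) (ht : 0 < t) (f : Site P i → Matrix (Fin N) (Fin N) ℂ)
    (hfast : t * ∑ x : Site P i, ∑ a : Fin N, ∑ b : Fin N, Complex.normSq (f x a b)
      ≤ ∑ b : PBond P i, ∑ a : Fin N, ∑ b' : Fin N,
          Complex.normSq (covD (torusT P i) (fun κ z => unitsField (toUField W) ⟨z, κ⟩) b.dir f b.src a b'))
    (D : PBond P i → Matrix (Fin N) (Fin N) ℂ)
    (hD : ∀ b : PBond P i, D b = covD (torusT P i) (fun κ z => unitsField (toUField W) ⟨z, κ⟩) b.dir f b.src) :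
    (∑ p : Plaq P i, ‖((Complex.I • D ⟨p.src, p.μ⟩)
          + ((W ⟨p.src, p.μ⟩ : Matrix (Fin N) (Fin N) ℂ) * (Complex.I • D ⟨p.src.shift p.μ, p.ν⟩) * star (W ⟨p.src, p.μ⟩ : Matrix (Fin N) (Fin N) ℂ))
          - (((W ⟨p.src, p.μ⟩ * W ⟨p.src.shift p.μ, p.ν⟩ * (W ⟨p.src.shift p.ν, p.μ⟩)⁻¹ : Matrix.specialUnitaryGroup (Fin N) ℂ) : Matrix (Fin N) (Fin N) ℂ)
              * (Complex.I • D ⟨p.src.shift p.ν, p.μ⟩)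
              * star ((W ⟨p.src, p.μ⟩ * W ⟨p.src.shift p.μ, p.ν⟩ * (W ⟨p.src.shift p.ν, p.μ⟩)⁻¹ : Matrix.specialUnitaryGroup (Fin N) ℂ) : Matrix (Fin N) (Fin N) ℂ))
          - (((GaugeField.plaqHol W p : Matrix.specialUnitaryGroup (Fin N) ℂ) : Matrix (Fin N) (Fin N) ℂ) * (Complex.I • D ⟨p.src, p.ν⟩)
              * star ((GaugeField.plaqHol W p : Matrix.specialUnitaryGroup (Fin N) ℂ) : Matrix (Fin N) (Fin N) ℂ)))‖ ^ 2)
      ≤ 4 * a ^ 2 * ((P.d : ℝ) ^ 2 * (t⁻¹ * ∑ b : PBond P i, ∑ a : Fin N, ∑ b' : Fin N,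
          Complex.normSq (covD (torusT P i) (fun κ z => unitsField (toUField W) ⟨z, κ⟩) b.dir f b.src a b'))) := by
  rw [← sum_dir_site_normSq_covD_eq_sum_pbond W f] at hfast ⊢
  exact plaqK_covD_fast_le W hW ht f hfast D hD

end Summit.QuantumFields.YangMills.Theorems.Prop7CovDPlaqKFast

end
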